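import Summits.CriticalPhenomena.SAWScalingLimit.Theses.SAWTrackTransport

/-!
# Line `birth` — registered skeleton for the crux `AngleUniversality` (stmt-CriticalPhenomena-16963)

Crux (FIXED; rank 2 of `route-CriticalPhenomena-SAWTrackTransport`, sub-problem `SAWScalingLimit`):

  `AngleUniversality := ∀ α ∈ [π/3, 2π/3], ∀ P chordal, RL(π/2) P → RL(α) P`,

where `RL(θ) P` ("`P` is the ROBUST FULL LIMIT of the critical Yang–Baxter walk at constant angle
`θ`") says: for every Dobrushin domain `D`, every family of sub-mesh shifts `u δ` (`‖u δ‖ ≤ δ`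
eventually), and every family of mid-edge endpoints `a δ, b δ` joined in `(D + u δ)_δ` eventually and
whose rescaled midpoints tend to the marked points, the critical law
`ybLaw (fun _ => θ) (D + u δ) δ 1 (a δ) (b δ)` pushed to `CurveClass ℂ` by `YBWalk.curve` converges in
law (`TendstoLaw`, i.e. on every bounded continuous test function) to `P D` as `δ → 0⁺`
(`RobustLimit` below is that `let RL` verbatim; `angleUniversality_iff` is `Iff.rfl`).

## The cut — what a COUPLING argument actually delivers, and the two soft complements it needs

DKKMO's track transport (arXiv:2012.11672, Thm 2.1) never identifies a limit: it COMPARES two lattice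
laws through a measure-preserving coupling under which marked points move by `< ε` with high
probability. A coupling with small displacement controls the difference of expectations of
LIPSCHITZ observables (`|∫ g dℙ_α − ∫ g dℙ_{π/2}| ≤ Lip(g)·ε + 2‖g‖∞·ℙ[displacement ≥ ε]`), and
nothing more. So the honest output of the transport is the lattice statement

* T  `stub_trackTransport` (HARDEST; the n = 0 DKKMO engine, in Dobrushin domains) — for every
  `α ∈ [π/3, 2π/3]` and every `α`-admissible datum `(D, u, a, b)` there is a `π/2`-admissible datum
  `(D, u', a', b')` (sub-mesh shifts and square-tiling endpoints of the SAME domain) such that for every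
  bounded Lipschitz `g : CurveClass ℂ →ᵇ ℝ` the critical `α`-law and the critical `π/2`-law of the
  drawn curve have asymptotically equal `g`-expectations as `δ → 0⁺`. Strictly lattice-level (no limit
  object, no tightness), strictly weaker than convergence of either family, TRUE in the conjectured
  world (both families converge to chordal SLE_{8/3}); intended proof = Glazman–Manolescu column
  exchanges (GlazmanManolescu2019 §3) as a coupling of walks + the n = 0 ZERO-DRIFT identity for the
  mesoscopic sub-arc extrema + a nails-to-curve lemma (DKKMO Thm 2.2 analogue) + the boundary layer of
  the domain (the part DKKMO never had to do: their transport is in infinite volume). Size XL. This is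
  the `Transfer:` of the crux to its stronger lattice form C⁺ and WHY it is easier: C⁺ is exactly the
  shape a coupling proves, with the test class (Lipschitz) matched to the control (displacement).
* L  `stub_lipschitzTransfer` (the "Slutsky-type perturbation lemma for `TendstoLaw`" listed under the
  route's NOT DECOMPOSED YET) — along `𝓝[>] 0`, if `Y₁` under `μ₁` tends in law to a probability
  measure `ν` on `CurveClass ℂ`, the `μ₂ δ` are eventually probability measures, `Y₂ δ` is measurable,
  and `∫ g∘Y₂ dμ₂ − ∫ g∘Y₁ dμ₁ → 0` for every bounded Lipschitz `g`, then `Y₂` under `μ₂` tends in law to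
  `ν` (on ALL bounded continuous test functions). Content: bounded Lipschitz functions are
  convergence-determining for probability measures on a metric space (portmanteau through
  `(1 − n·dist(·, F))⁺ ↓ 1_F`; `𝓝[>] 0` is countably generated, so Mathlib's sequential portmanteau
  `MeasureTheory.tendsto_of_forall_isClosed_limsup_le` / `limsup_measure_closed_le_iff_liminf_measure_open_ge`
  apply). Folklore (Billingsley, Convergence of probability measures, Thm 2.1/3.1; Dudley §11.3), not in
  the tree (`lean search 'TendstoLaw'`: only `tendstoLaw_iff_tendstoInDistribution`, `TendstoLaw.unique`,
  `TendstoLaw.comp_continuous`). Size M. It is where "probability measure" becomes load-bearing: with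
  `g ≡ 1` Lipschitz, T already forces the total masses to agree asymptotically, but the upgrade from
  Lipschitz to continuous test functions is false for non-tight families of finite measures.
* W  `stub_ybLawIsProbability` (well-posedness of the critical finite-domain law) — for constant angle
  `θ ∈ [π/3, 2π/3]`, bounded `Ω`, mesh `δ > 0` and mid-edges `a, b` joined by at least one walk of
  `Ω_δ`, `ybLaw (fun _ => θ) Ω δ 1 a b` is a probability measure: the partition function is `< ∞`
  (boundedly many faces `f` with `δ·rhombus f ⊆ Ω` since `sin θ ≥ √3/2`, hence finitely many walks) and
  `> 0` (SHORT-CUTTING a walk at every twice-visited rhombus yields a face-simple walk, whose weight is a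
  product of `u₁(θ), u₂(θ), v(θ) > 0` on the CLOSED interval — while `w₂(π/3) = w₁(2π/3) = 0`, so
  `Nonempty` alone does not give positive mass without this argument). Tree input:
  `isProbabilityMeasure_ybLaw` (from `Z ≠ 0, Z ≠ ⊤`). Size S–M.

`AngleUniversality_of` (kernel-checked, no `sorry` of its own): given `α`, a chordal `P` with
`RL(π/2) P` and an `α`-admissible datum, T produces the coupled `π/2`-datum and the Lipschitz
comparison, `RL(π/2) P` gives the limit `P D` for that datum, W (fed with `(D + u δ).isBounded` and the
eventual non-emptiness) makes the `α`-laws eventually probability measures, `P.IsChordal` makes `P D`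
one, `YBWalk.measurable_of_top` gives measurability, and L concludes `RL(α)` for the datum. Its
hypotheses are the three stubs under their registered names (`__Registered.stub_…`, the device of
`Cruxes/AxiomsOfLimit/Lines/birth.lean`: the native skeleton audit admits a `Prop` hypothesis only by
the NAME of a registered obligation / declared stub), its conclusion is the route decl
`Summit.CriticalPhenomena.SAWScalingLimit.Theses.SAWTrackTransport.AngleUniversality` BY NAME.

Every stub is stated over TREE VOCABULARY ONLY (lands verbatim as
`Theorems/SAWTrackTransportAngleUniversality<Stub>.lean --supports stmt-CriticalPhenomena-16963`); the
named statements `TrackTransport`, `LipschitzTransfer`, `YBLawIsProbability` and the `*_holds`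
theorems certify definitionally that the unfolded text IS the named statement.

Disproof used: none exists — `ledger crux ls stmt-CriticalPhenomena-16963` lists no workfiles
(2026-08-17), so there is no `_false_without_` obstruction to honour yet. Negatives index
(`ledger negatives --problem CriticalPhenomena`, 11 entries) checked: the only SAW-limit entry is
stmt-CriticalPhenomena-0772 (`IsTightLaws` over ALL `δ ∈ (0,1]` refuted by far-away coincident
endpoints); every statement here is eventual along `𝓝[>] 0` or carries `Nonempty`/`0 < δ`/boundedness
explicitly, and no tightness is asserted. Foreseen next split (tenure, not filed): T ⇐ {ZeroDrift (needs
the definition item `YBCylinderTransferMatrix` of the route header), NailTransport (marked sub-arc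
extrema move `o(1)` in probability under the GM coupling), NailsToCurve (deterministic: `η`-nails in
three directions without ties determine a simple curve to reparametrisation-precision `κ(η) → 0`),
BoundaryLayer (domain discretisations of the two tilings differ in an `O(δ)`-collar only)}.
-/

noncomputable section

open MeasureTheory Filter Topology Set Bornology
open scoped NNReal ENNReal BoundedContinuousFunction
open Literature.Probability.RandomPlanarGeometry Literature.Probability.RandomPlanarGeometry.SAW.YangBaxter

namespace Summit.CriticalPhenomena.SAWScalingLimit.Cruxes.AngleUniversality.Birth

/-! ### Vocabulary of the line: the robust limit and the three named statements -/

/-- `RobustLimit θ P` — VERBATIM the `let RL` of the crux: `P` is the robust full chordal scaling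
limit of the critical (`x = 1`) Yang–Baxter walk on the rhombic tiling of constant angle `θ`, curves
drawn in the isoradial embedding `planeMidpoint (fun _ => θ)`, for every Dobrushin domain, every family
of sub-mesh shifts and every admissible family of mid-edge endpoints. -/
def RobustLimit (θ : ℝ) (P : ChordalFamily) : Prop :=
  ∀ (D : DobrushinDomain) (u : ℝ → ℂ) (a b : ℝ → MidEdge),
    (∀ᶠ δ in 𝓝[>] (0 : ℝ), ‖u δ‖ ≤ δ) →
    (∀ᶠ δ in 𝓝[>] (0 : ℝ), Nonempty (YangBaxterSAW (fun (_ : ℤ) => θ)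
      ((D.map (similarity 1 one_ne_zero (u δ))).carrier) δ (a δ) (b δ))) →
    Tendsto (fun δ : ℝ => (δ : ℂ) * planeMidpoint (fun (_ : ℤ) => θ) (a δ)) (𝓝[>] (0 : ℝ))
      (𝓝 (D.pt 0)) →
    Tendsto (fun δ : ℝ => (δ : ℂ) * planeMidpoint (fun (_ : ℤ) => θ) (b δ)) (𝓝[>] (0 : ℝ))
      (𝓝 (D.pt 1)) →
    TendstoLaw
      (fun δ (γ : YangBaxterSAW (fun (_ : ℤ) => θ)
        ((D.map (similarity 1 one_ne_zero (u δ))).carrier) δ (a δ) (b δ)) =>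
          γ.curve (fun (_ : ℤ) => θ) δ)
      (fun δ => ybLaw (fun (_ : ℤ) => θ) ((D.map (similarity 1 one_ne_zero (u δ))).carrier) δ 1
        (a δ) (b δ))
      id (P D)

/-- Consistency: the crux IS "`RobustLimit (π/2) P → RobustLimit α P` for every `α ∈ [π/3, 2π/3]` and
every chordal `P`" — definitionally. -/
theorem angleUniversality_iff :
    Summit.CriticalPhenomena.SAWScalingLimit.Theses.SAWTrackTransport.AngleUniversality ↔
      ∀ α ∈ Set.Icc (Real.pi / 3) (2 * Real.pi / 3), ∀ P : ChordalFamily, P.IsChordal →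
        RobustLimit (Real.pi / 2) P → RobustLimit α P :=
  Iff.rfl

/-- **T, named.** Track transport at `n = 0`, in Dobrushin domains, as a bounded-Lipschitz asymptotic
equality of the critical `α`-law and a coupled critical `π/2`-law of the drawn curve. -/
def TrackTransport : Prop :=
  ∀ α ∈ Set.Icc (Real.pi / 3) (2 * Real.pi / 3),
    ∀ (D : DobrushinDomain) (u : ℝ → ℂ) (a b : ℝ → MidEdge),
      (∀ᶠ δ in 𝓝[>] (0 : ℝ), ‖u δ‖ ≤ δ) →
      (∀ᶠ δ in 𝓝[>] (0 : ℝ), Nonempty (YangBaxterSAW (fun (_ : ℤ) => α)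
        ((D.map (similarity 1 one_ne_zero (u δ))).carrier) δ (a δ) (b δ))) →
      Tendsto (fun δ : ℝ => (δ : ℂ) * planeMidpoint (fun (_ : ℤ) => α) (a δ)) (𝓝[>] (0 : ℝ))
        (𝓝 (D.pt 0)) →
      Tendsto (fun δ : ℝ => (δ : ℂ) * planeMidpoint (fun (_ : ℤ) => α) (b δ)) (𝓝[>] (0 : ℝ))
        (𝓝 (D.pt 1)) →
      ∃ (u' : ℝ → ℂ) (a' b' : ℝ → MidEdge),
        (∀ᶠ δ in 𝓝[>] (0 : ℝ), ‖u' δ‖ ≤ δ) ∧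
        (∀ᶠ δ in 𝓝[>] (0 : ℝ), Nonempty (YangBaxterSAW (fun (_ : ℤ) => Real.pi / 2)
          ((D.map (similarity 1 one_ne_zero (u' δ))).carrier) δ (a' δ) (b' δ))) ∧
        Tendsto (fun δ : ℝ => (δ : ℂ) * planeMidpoint (fun (_ : ℤ) => Real.pi / 2) (a' δ))
          (𝓝[>] (0 : ℝ)) (𝓝 (D.pt 0)) ∧
        Tendsto (fun δ : ℝ => (δ : ℂ) * planeMidpoint (fun (_ : ℤ) => Real.pi / 2) (b' δ))
          (𝓝[>] (0 : ℝ)) (𝓝 (D.pt 1)) ∧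
        ∀ (g : CurveClass ℂ →ᵇ ℝ) (K : ℝ≥0), LipschitzWith K g →
          Tendsto (fun δ : ℝ =>
              (∫ γ, g (γ.curve (fun (_ : ℤ) => α) δ)
                  ∂(ybLaw (fun (_ : ℤ) => α) ((D.map (similarity 1 one_ne_zero (u δ))).carrier) δ 1
                      (a δ) (b δ))) -
                ∫ γ, g (γ.curve (fun (_ : ℤ) => Real.pi / 2) δ)
                  ∂(ybLaw (fun (_ : ℤ) => Real.pi / 2)
                      ((D.map (similarity 1 one_ne_zero (u' δ))).carrier) δ 1 (a' δ) (b' δ)))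
            (𝓝[>] (0 : ℝ)) (𝓝 0)

/-- **L, named.** Bounded Lipschitz observables are convergence-determining along `𝓝[>] 0` for
eventually-probability families of laws on `CurveClass ℂ`: a Lipschitz-asymptotically-equal family
inherits the `TendstoLaw` limit. -/
def LipschitzTransfer : Prop :=
  ∀ (Ω₁ Ω₂ : ℝ → Type) [∀ δ, MeasurableSpace (Ω₁ δ)] [∀ δ, MeasurableSpace (Ω₂ δ)]
    (Y₁ : ∀ δ, Ω₁ δ → CurveClass ℂ) (Y₂ : ∀ δ, Ω₂ δ → CurveClass ℂ)
    (μ₁ : ∀ δ, Measure (Ω₁ δ)) (μ₂ : ∀ δ, Measure (Ω₂ δ)) (ν : Measure (CurveClass ℂ)),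
    IsProbabilityMeasure ν →
    (∀ᶠ δ in 𝓝[>] (0 : ℝ), IsProbabilityMeasure (μ₂ δ)) →
    (∀ δ, Measurable (Y₂ δ)) →
    TendstoLaw Y₁ μ₁ id ν →
    (∀ (g : CurveClass ℂ →ᵇ ℝ) (K : ℝ≥0), LipschitzWith K g →
      Tendsto (fun δ : ℝ => (∫ ω, g (Y₂ δ ω) ∂μ₂ δ) - ∫ ω, g (Y₁ δ ω) ∂μ₁ δ) (𝓝[>] (0 : ℝ))
        (𝓝 0)) →
    TendstoLaw Y₂ μ₂ id ν

/-- **W, named.** The critical finite-domain Yang–Baxter law at constant angle `θ ∈ [π/3, 2π/3]` in a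
bounded domain at positive mesh is a probability measure as soon as one walk joins the endpoints. -/
def YBLawIsProbability : Prop :=
  ∀ θ ∈ Set.Icc (Real.pi / 3) (2 * Real.pi / 3), ∀ (Ω : Set ℂ), Bornology.IsBounded Ω →
    ∀ (δ : ℝ), 0 < δ → ∀ (a b : MidEdge), Nonempty (YangBaxterSAW (fun (_ : ℤ) => θ) Ω δ a b) →
      IsProbabilityMeasure (ybLaw (fun (_ : ℤ) => θ) Ω δ 1 a b)

/-! ### The stubs (the ONLY `sorry`s of this file), in tree vocabulary -/

/-- **T — track transport at `n = 0` in Dobrushin domains (HARDEST; the DKKMO engine).** For every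
`α ∈ [π/3, 2π/3]` and every `α`-admissible datum `(D, u, a, b)` — sub-mesh shifts `‖u δ‖ ≤ δ`
eventually, mid-edges `a δ, b δ` joined in `(D + u δ)_δ` eventually, rescaled midpoints tending to the
marked points — there is a `π/2`-admissible datum `(D, u', a', b')` of the SAME Dobrushin domain such
that the critical `α`-law and the critical `π/2`-law of the drawn curve have asymptotically equal
expectations on every bounded Lipschitz observable of `CurveClass ℂ`. Intended proof: Glazman–Manolescu
column exchanges bring the `α`-columns through the `π/2`-columns as a measure-preserving COUPLING of
walks (GM §3, Thms 1–3 use it for partition functions only); per exchange the curve moves `O(δ)`; the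
accumulated displacement of its mesoscopic sub-arc extrema is `o(1)` in probability by the `n = 0`
ZERO-DRIFT identity (`ℙ[apex jumps to the far line] = sin α/(sin α + sin β)`, from commuting column
transfer matrices and the `sin θ`-anisotropy of the dilute-O(0) gaps — unproved, Bethe-ansatz level);
nails without ties determine the curve in the reparametrisation metric; the two domain discretisations
differ only in an `O(δ)`-collar. Why it might fail: zero drift at `n = 0`; no RSW to separate competing
extrema; the boundary collar is new (DKKMO transport is in infinite volume).
[DKKMO2020Rotational Thm 2.1/2.4; GlazmanManolescu2019 §3; arXiv:2012.11675] -/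
theorem stub_trackTransport :
    ∀ α ∈ Set.Icc (Real.pi / 3) (2 * Real.pi / 3),
    ∀ (D : DobrushinDomain) (u : ℝ → ℂ) (a b : ℝ → MidEdge),
      (∀ᶠ δ in 𝓝[>] (0 : ℝ), ‖u δ‖ ≤ δ) →
      (∀ᶠ δ in 𝓝[>] (0 : ℝ), Nonempty (YangBaxterSAW (fun (_ : ℤ) => α)
        ((D.map (similarity 1 one_ne_zero (u δ))).carrier) δ (a δ) (b δ))) →
      Tendsto (fun δ : ℝ => (δ : ℂ) * planeMidpoint (fun (_ : ℤ) => α) (a δ)) (𝓝[>] (0 : ℝ))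
        (𝓝 (D.pt 0)) →
      Tendsto (fun δ : ℝ => (δ : ℂ) * planeMidpoint (fun (_ : ℤ) => α) (b δ)) (𝓝[>] (0 : ℝ))
        (𝓝 (D.pt 1)) →
      ∃ (u' : ℝ → ℂ) (a' b' : ℝ → MidEdge),
        (∀ᶠ δ in 𝓝[>] (0 : ℝ), ‖u' δ‖ ≤ δ) ∧
        (∀ᶠ δ in 𝓝[>] (0 : ℝ), Nonempty (YangBaxterSAW (fun (_ : ℤ) => Real.pi / 2)
          ((D.map (similarity 1 one_ne_zero (u' δ))).carrier) δ (a' δ) (b' δ))) ∧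
        Tendsto (fun δ : ℝ => (δ : ℂ) * planeMidpoint (fun (_ : ℤ) => Real.pi / 2) (a' δ))
          (𝓝[>] (0 : ℝ)) (𝓝 (D.pt 0)) ∧
        Tendsto (fun δ : ℝ => (δ : ℂ) * planeMidpoint (fun (_ : ℤ) => Real.pi / 2) (b' δ))
          (𝓝[>] (0 : ℝ)) (𝓝 (D.pt 1)) ∧
        ∀ (g : CurveClass ℂ →ᵇ ℝ) (K : ℝ≥0), LipschitzWith K g →
          Tendsto (fun δ : ℝ =>
              (∫ γ, g (γ.curve (fun (_ : ℤ) => α) δ)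
                  ∂(ybLaw (fun (_ : ℤ) => α) ((D.map (similarity 1 one_ne_zero (u δ))).carrier) δ 1
                      (a δ) (b δ))) -
                ∫ γ, g (γ.curve (fun (_ : ℤ) => Real.pi / 2) δ)
                  ∂(ybLaw (fun (_ : ℤ) => Real.pi / 2)
                      ((D.map (similarity 1 one_ne_zero (u' δ))).carrier) δ 1 (a' δ) (b' δ)))
            (𝓝[>] (0 : ℝ)) (𝓝 0) := by
  sorry

/-- **L — bounded-Lipschitz asymptotic equality transfers `TendstoLaw` limits** (the Slutsky-type
perturbation lemma for `TendstoLaw` of the route header). Along `𝓝[>] 0`: `Y₁` under `μ₁` tends in law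
to the probability measure `ν` on `CurveClass ℂ`; the `μ₂ δ` are eventually probability measures and
each `Y₂ δ` is measurable; every bounded Lipschitz `g` has `∫ g∘Y₂ dμ₂ − ∫ g∘Y₁ dμ₁ → 0`. Then `Y₂`
under `μ₂` tends in law to `ν`. Proof plan: `∫ g∘Y₂ dμ₂ → ∫ g dν` for bounded Lipschitz `g`; push
forward to probability measures on the metric Borel space `CurveClass ℂ`; closed `F`:
`limsup μ₂(Y₂ ∈ F) ≤ inf_n ∫ (1 − n·infDist(·, F))⁺ dν = ν F`; portmanteau
(`MeasureTheory.tendsto_of_forall_isClosed_limsup_le`-type, along sequences since `𝓝[>] 0` is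
countably generated); back to bounded continuous test functions. No probability hypothesis on `μ₁` is
needed. [Billingsley 1999 Thm 2.1, Thm 3.1; Dudley, Real analysis and probability, §11.3] -/
theorem stub_lipschitzTransfer :
    ∀ (Ω₁ Ω₂ : ℝ → Type) [∀ δ, MeasurableSpace (Ω₁ δ)] [∀ δ, MeasurableSpace (Ω₂ δ)]
      (Y₁ : ∀ δ, Ω₁ δ → CurveClass ℂ) (Y₂ : ∀ δ, Ω₂ δ → CurveClass ℂ)
      (μ₁ : ∀ δ, Measure (Ω₁ δ)) (μ₂ : ∀ δ, Measure (Ω₂ δ)) (ν : Measure (CurveClass ℂ)),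
      IsProbabilityMeasure ν →
      (∀ᶠ δ in 𝓝[>] (0 : ℝ), IsProbabilityMeasure (μ₂ δ)) →
      (∀ δ, Measurable (Y₂ δ)) →
      TendstoLaw Y₁ μ₁ id ν →
      (∀ (g : CurveClass ℂ →ᵇ ℝ) (K : ℝ≥0), LipschitzWith K g →
        Tendsto (fun δ : ℝ => (∫ ω, g (Y₂ δ ω) ∂μ₂ δ) - ∫ ω, g (Y₁ δ ω) ∂μ₁ δ) (𝓝[>] (0 : ℝ))
          (𝓝 0)) →
      TendstoLaw Y₂ μ₂ id ν := by
  sorry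

/-- **W — the critical Yang–Baxter law of a bounded domain is a probability measure as soon as one
walk joins the endpoints.** For constant angle `θ ∈ [π/3, 2π/3]`, bounded `Ω ⊆ ℂ`, mesh `δ > 0` and
mid-edges `a, b` with `Nonempty (YangBaxterSAW (fun _ => θ) Ω δ a b)`: the partition function
`ybWeight … Set.univ` is `≠ ⊤` — the faces `f` with `δ · rhombus θ f ⊆ Ω` are finitely many
(`planeCorner θ (k, j) = k sin θ + i (j − 1/2 − k cos θ)` with `sin θ ≥ √3/2`), so the walks (duplicate-
free lists of sides of those faces, or the trivial walk) form a finite type — and `≠ 0` — short-cutting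
a walk at every rhombus it visits twice (replace `s₁ → s₂, …, s₃ → s₄` by the single arc `s₁ → s₄`; the
list stays duplicate-free, arcs stay in faces of `Ω_δ`, consecutive arcs stay in different faces, no
crossing pair is created) yields a FACE-SIMPLE walk, whose weight is a product of single-arc weights
`u₁(θ), u₂(θ), v(θ)`, all `> 0` on the closed interval (whereas `w₂(π/3) = w₁(2π/3) = 0`); conclude by
`isProbabilityMeasure_ybLaw`. [GlazmanManolescu2019 §1 eq. (1), Fig. 1–2; folklore] -/
theorem stub_ybLawIsProbability :
    ∀ θ ∈ Set.Icc (Real.pi / 3) (2 * Real.pi / 3), ∀ (Ω : Set ℂ), Bornology.IsBounded Ω →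
      ∀ (δ : ℝ), 0 < δ → ∀ (a b : MidEdge), Nonempty (YangBaxterSAW (fun (_ : ℤ) => θ) Ω δ a b) →
        IsProbabilityMeasure (ybLaw (fun (_ : ℤ) => θ) Ω δ 1 a b) := by
  sorry

/-! ### Consistency: each named statement IS its registered stub (definitionally) -/

theorem trackTransport_holds : TrackTransport := stub_trackTransport
theorem lipschitzTransfer_holds : LipschitzTransfer := stub_lipschitzTransfer
theorem ybLawIsProbability_holds : YBLawIsProbability := stub_ybLawIsProbability

/-! ### Name-keyed aliases of the three statements — the hypotheses of `AngleUniversality_of`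

The native skeleton audit (`#h21_check_skeleton`) admits a `Prop` hypothesis of the skeleton theorem only
if its head constant is a registered obligation or is NAMED like a declared stub; `__Registered.stub_X`
is the statement of `stub_X` under that name (the `__` namespace is an implementation detail, so the
audit's stub report resolves each `stub_…` to the sorried theorem above, not to the alias). Each alias is
`rfl`-equal to its named statement and definitionally equal to the type of its stub. -/
namespace __Registered

/-- Alias of `TrackTransport` keyed by the registered stub name. -/
abbrev stub_trackTransport : Prop := TrackTransport
/-- Alias of `LipschitzTransfer` keyed by the registered stub name. -/
abbrev stub_lipschitzTransfer : Prop := LipschitzTransfer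
/-- Alias of `YBLawIsProbability` keyed by the registered stub name. -/
abbrev stub_ybLawIsProbability : Prop := YBLawIsProbability

end __Registered

/-! ### The skeleton theorem: the three stubs imply the crux, BY NAME -/

/-- **`AngleUniversality` from the line `birth`** (kernel-checked, no `sorry` of its own). Given
`α ∈ [π/3, 2π/3]`, a chordal `P` with `RL(π/2) P` and an `α`-admissible datum `(D, u, a, b)`: T yields a
coupled `π/2`-admissible datum `(D, u', a', b')` with the bounded-Lipschitz comparison; `RL(π/2) P`
applied to it gives `TendstoLaw … (P D)` for the square-tiling family; W (with `(D + u δ).isBounded`,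
`δ > 0` and the eventual non-emptiness) makes the `α`-laws eventually probability measures; `P.IsChordal`
makes `P D` one; `YBWalk.measurable_of_top` gives measurability of the drawn curve; L transfers the
limit to the `α`-family, which is `RL(α) P` at the datum. Hypotheses = the three stubs under their
registered names; conclusion = the route decl, by name. -/
theorem AngleUniversality_of (hT : __Registered.stub_trackTransport)
    (hL : __Registered.stub_lipschitzTransfer) (hW : __Registered.stub_ybLawIsProbability) :
    Summit.CriticalPhenomena.SAWScalingLimit.Theses.SAWTrackTransport.AngleUniversality := by
  intro α hα P hP hsq D u a b hu hne ha hb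
  obtain ⟨u', a', b', hu', hne', ha', hb', hcmp⟩ := hT α hα D u a b hu hne ha hb
  -- the robust square-tiling limit at the coupled datum
  have hlim := hsq D u' a' b' hu' hne' ha' hb'
  -- the `α`-laws are eventually probability measures
  have hprob : ∀ᶠ δ in 𝓝[>] (0 : ℝ), IsProbabilityMeasure
      (ybLaw (fun (_ : ℤ) => α) ((D.map (similarity 1 one_ne_zero (u δ))).carrier) δ 1 (a δ)
        (b δ)) := by
    filter_upwards [hne, self_mem_nhdsWithin] with δ hδ hpos
    exact hW α hα _ (D.map (similarity 1 one_ne_zero (u δ))).isBounded δ hpos (a δ) (b δ) hδ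
  exact hL _ _ _ _ _ _ (P D) (hP D).1 hprob (fun δ => YBWalk.measurable_of_top _) hlim hcmp

/-- Wiring check (an `example`, so that `AngleUniversality_of` stays the only theorem concluding the
crux): the registered stubs, with their tree-vocabulary types, feed the skeleton theorem as stated —
this term becomes the crux proof when the three `sorry`s above are discharged. -/
example : Summit.CriticalPhenomena.SAWScalingLimit.Theses.SAWTrackTransport.AngleUniversality :=
  AngleUniversality_of stub_trackTransport stub_lipschitzTransfer stub_ybLawIsProbability

end Summit.CriticalPhenomena.SAWScalingLimit.Cruxes.AngleUniversality.Birth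

end
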